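import Summits.Ventures.CertifiedQuantumChemistry.Rows.GapCertificateCodimOne
import Literature.MathematicalPhysics.QuantumChemistry.FirstOrderPerturbationBounds
import HarnessLib

/-!
# Ventures/CertifiedQuantumChemistry — Rows/DifferenceSlopeRows.lean: SOUNDNESS of FIRST-ORDER
# ("slope", Feynman–Hellmann) DIFFERENCE certificates — a certified enclosure of the ground-state
# expectation `⟨H_A − H_B⟩` at ONE endpoint proves a one-sided difference row `DiffLowerRow` /
# `DiffUpperRow` of `Rows/DifferenceRows.lean`; the λ-grid step between consecutive combined files;
# and the enclosure itself from a codimension-one gap certificate plus one explicit state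

HONEST FRAMING (verbatim): certified bounds for a stated model Hamiltonian in a stated basis; not a
claim about the real molecule or material beyond that model.

Typer chem-type-09 (LADDER-CHEM I-TYPE slot 09, cell chem-oracle; director-chem 2026-08-26T18:56:58Z
«FLOOR-BREAKER (Hellmann–Feynman slope ⟨ψ_λ|H_B − H_A|ψ_λ⟩ from a certified state + residual/gap
enclosure) = the I-DIFF RESEARCH line»; chem-lead B5-7). The pair `(F_A, F_B)` lives on ONE orbital space
`Fin k` and ONE sector `(a, b)`; `V := Ĥ(F_A) − Ĥ(F_B)`.

## The certificate and why it is sound (`Literature/…/FirstOrderPerturbationBounds.lean`, p469381)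
Tangent sandwich (Thirring (4.3.20; 1), Feynman–Hellmann one-sided): for sector ground states `ψ_B` of
`Ĥ(F_B)` and `ψ_A` of `Ĥ(F_A)`, `Re⟨ψ_A, Vψ_A⟩ ≤ E₀(A) − E₀(B) ≤ Re⟨ψ_B, Vψ_B⟩`. Hence an ENCLOSURE of
`Re⟨ψ, Vψ⟩ ≤ hi` over ALL unit sector ground eigenvectors `ψ` of `Ĥ(F_B)` proves `DiffUpperRow … hi`
(`diffUpperRow_of_forall_ground`), and `lo ≤ Re⟨φ, Vφ⟩` over those of `Ĥ(F_A)` proves `DiffLowerRow … lo`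
(`diffLowerRow_of_forall_ground`). Along the SEGMENT `F(s) = (1 − s)·F_B + s·F_A = Model.lincomb (1−s) s
F_B F_A` (`Model.hamiltonian_segment`: `Ĥ(F(s)) = Ĥ(F_B) + s·V`) the same holds between consecutive grid
files with the factor `(t − s)` (`diffUpperRow_segment_of_forall_ground`, `diffLowerRow_segment_…`):
one Riemann panel of the concave `E(s)`; panels chain by `DiffLowerRow.trans` / `DiffUpperRow.trans`
(`Rows/DifferenceRows.lean`). The width of an `n`-panel sandwich is `(⟨V⟩₀ − ⟨V⟩₁)/n` + the enclosure
slacks — NO window multiplier and NO absolute bracket of either endpoint enters.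

## How the enclosure is certified (§3): `GapCertificateCodimOne` + ONE explicit state
`forall_ground_abs_re_rayleigh_sub_le`: from a codimension-one gap certificate `σ` for `F` in the sector
(`Rows/GapCertificateCodimOne.lean`), one explicit sector vector `w` with exact sums `N = ⟨w, w⟩ > 0`,
`⟨w, H_F w⟩ = ρN`, `⟨H_F w, H_F w⟩ ≤ (r2 + ρ²)N`, `ρ < σ`, a Hermitian observable `O` with a form bound
`|⟨x, (O − m)x⟩| ≤ h‖x‖²`, its exact data `⟨w, Ow⟩ = oN`, `‖(O − o)w‖² ≤ sO²·N`, and any `β ≥ 0` with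
`r2 ≤ β²(σ − ρ)²`: EVERY unit sector ground eigenvector `ψ` of `H_F` has `|Re⟨ψ, Oψ⟩ − o| ≤ 2βsO +
β²(h + |o − m|)` (the tree's `TempleKato.sector_enclosure` — the certificate forces a SIMPLE sector ground
state within angle `β` of `w` — and `TempleKato.abs_expect_sub_expect_le_of_residual`, cited). With
`O = V` this is the slope enclosure; `diffUpperRow_of_slope_certificate` / `diffLowerRow_of_slope_certificate`
compose it with §1 end to end.

What is NOT here: the zero-order `dE-direct:d` pencil rows (`Rows/DifferencePencilRows.lean`); Temple
rows (`Rows/TempleLowerRow.lean`, `Rows/GapCertificateCodimOne.lean`); any certificate instance, number,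
or claim node; a format for `(o, sO, h, m)` (solver seats). Whether the slope line beats absolutes is
chem-solver-6's / chem-idea-1's measured question (LADDER §7.4), not a claim of this file.
References: Thirring (2002) (4.3.20; 1–2), (4.3.38; 2) [cite: Thirring2002QMP, (4.3.20; 1)]; Saad (1992)
Ch. III §3.2 Thms 3.8–3.9 (Kato–Temple, eigenvector bound) via the tree's `GroundStateEnclosureCertificate`.
-/

noncomputable section

namespace Summit.Ventures.CertifiedQuantumChemistry

open Matrix Finset
open Literature.MathematicalPhysics.QuantumLattice Literature.MathematicalPhysics.QuantumChemistry
open Literature.MathematicalPhysics.QuantumLattice.EigenvalueContinuation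
open scoped ComplexOrder

variable {k : ℕ}

/-! ## §1 Two-file first-order difference rows from slope enclosures -/

/-- **First-order UPPER difference row.** For symmetric `F_A`, `F_B` on the same `k` orbitals, a sector
`a, b ≤ k`, and a rational `hi` such that EVERY unit `(a, b)`-sector ground eigenvector `ψ` of `Ĥ(F_B)`
has `Re⟨ψ, (Ĥ(F_A) − Ĥ(F_B))ψ⟩ ≤ hi`: `DiffUpperRow F_A a b F_B a b hi`, i.e. `E₀(A) − E₀(B) ≤ hi`
(tangent inequality at `B`, `sectorGroundEnergy_add_sub_le_of_forall_eigen`; Thirring (4.3.20; 1)).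
[cite: Thirring2002QMP, (4.3.20; 1)] -/
theorem diffUpperRow_of_forall_ground {FA FB : Model k} (hA : FA.IsSymmetric) (hB : FB.IsSymmetric)
    {a b : ℕ} (ha : a ≤ k) (hb : b ≤ k) {hi : ℚ}
    (hslope : ∀ ψ : Fock (Orb (Fin k)), IsInSector a b ψ → star ψ ⬝ᵥ ψ = 1 →
      FB.hamiltonian *ᵥ ψ = ((FB.energy a b : ℝ) : ℂ) • ψ →
        (star ψ ⬝ᵥ (FA.hamiltonian - FB.hamiltonian) *ᵥ ψ).re ≤ ((hi : ℚ) : ℝ)) :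
    DiffUpperRow FA a b FB a b hi := by
  refine ⟨⟨ha, hb⟩, ⟨ha, hb⟩, ?_⟩
  have e : FB.hamiltonian + (FA.hamiltonian - FB.hamiltonian) = FA.hamiltonian := add_sub_cancel _ _
  have h := sectorGroundEnergy_add_sub_le_of_forall_eigen (V := FA.hamiltonian - FB.hamiltonian)
    (Model.hamiltonian_isHermitian hB)
    ((Model.hamiltonian_isHermitian hA).sub (Model.hamiltonian_isHermitian hB))
    (molecularHamiltonian_commute_totalNumber _ _ _) (molecularHamiltonian_commute_spinZ _ _ _)
    (by simpa using ha) (by simpa using hb) hslope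
  rw [e] at h
  exact h

/-- **First-order LOWER difference row.** For symmetric `F_A`, `F_B` on the same `k` orbitals, a sector
`a, b ≤ k`, and a rational `lo` such that every unit `(a, b)`-sector ground eigenvector `φ` of `Ĥ(F_A)`
has `lo ≤ Re⟨φ, (Ĥ(F_A) − Ĥ(F_B))φ⟩`: `DiffLowerRow F_A a b F_B a b lo`, i.e. `lo ≤ E₀(A) − E₀(B)`
(tangent inequality at `A`, `le_sectorGroundEnergy_add_sub_of_forall_eigen`; Thirring (4.3.20; 1)).
[cite: Thirring2002QMP, (4.3.20; 1)] -/
theorem diffLowerRow_of_forall_ground {FA FB : Model k} (hA : FA.IsSymmetric) (hB : FB.IsSymmetric)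
    {a b : ℕ} (ha : a ≤ k) (hb : b ≤ k) {lo : ℚ}
    (hslope : ∀ φ : Fock (Orb (Fin k)), IsInSector a b φ → star φ ⬝ᵥ φ = 1 →
      FA.hamiltonian *ᵥ φ = ((FA.energy a b : ℝ) : ℂ) • φ →
        ((lo : ℚ) : ℝ) ≤ (star φ ⬝ᵥ (FA.hamiltonian - FB.hamiltonian) *ᵥ φ).re) :
    DiffLowerRow FA a b FB a b lo := by
  refine ⟨⟨ha, hb⟩, ⟨ha, hb⟩, ?_⟩
  have e : FB.hamiltonian + (FA.hamiltonian - FB.hamiltonian) = FA.hamiltonian := add_sub_cancel _ _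
  have h := le_sectorGroundEnergy_add_sub_of_forall_eigen (V := FA.hamiltonian - FB.hamiltonian)
    (Model.hamiltonian_isHermitian hB)
    ((Model.hamiltonian_isHermitian hA).sub (Model.hamiltonian_isHermitian hB))
    (molecularHamiltonian_commute_totalNumber _ _ _) (molecularHamiltonian_commute_spinZ _ _ _)
    ((molecularHamiltonian_commute_totalNumber _ _ _).sub_left
      (molecularHamiltonian_commute_totalNumber _ _ _))
    ((molecularHamiltonian_commute_spinZ _ _ _).sub_left (molecularHamiltonian_commute_spinZ _ _ _))
    (by simpa using ha) (by simpa using hb) (lo := ((lo : ℚ) : ℝ))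
    (fun φ hφ hφ1 hHφ => by
      rw [e] at hHφ
      exact hslope φ hφ hφ1 hHφ)
  rw [e] at h
  exact h

/-- **Two-sided first-order difference bracket** from slope enclosures at BOTH endpoints (`hi` over the
ground eigenvectors of `Ĥ(F_B)`, `lo` over those of `Ĥ(F_A)`): `DiffBracket F_A a b F_B a b lo hi`; its
width is `hi − lo = (⟨V⟩_B − ⟨V⟩_A)` + the two enclosure slacks (the curvature of `E(s)` across the pair,
LADDER §7.4's `|E″|`), independent of any absolute bracket. [cite: Thirring2002QMP, (4.3.20; 1)] -/
theorem diffBracket_of_forall_ground {FA FB : Model k} (hA : FA.IsSymmetric) (hB : FB.IsSymmetric)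
    {a b : ℕ} (ha : a ≤ k) (hb : b ≤ k) {lo hi : ℚ}
    (hlo : ∀ φ : Fock (Orb (Fin k)), IsInSector a b φ → star φ ⬝ᵥ φ = 1 →
      FA.hamiltonian *ᵥ φ = ((FA.energy a b : ℝ) : ℂ) • φ →
        ((lo : ℚ) : ℝ) ≤ (star φ ⬝ᵥ (FA.hamiltonian - FB.hamiltonian) *ᵥ φ).re)
    (hhi : ∀ ψ : Fock (Orb (Fin k)), IsInSector a b ψ → star ψ ⬝ᵥ ψ = 1 →
      FB.hamiltonian *ᵥ ψ = ((FB.energy a b : ℝ) : ℂ) • ψ →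
        (star ψ ⬝ᵥ (FA.hamiltonian - FB.hamiltonian) *ᵥ ψ).re ≤ ((hi : ℚ) : ℝ)) :
    DiffBracket FA a b FB a b lo hi :=
  ⟨diffLowerRow_of_forall_ground hA hB ha hb hlo, diffUpperRow_of_forall_ground hA hB ha hb hhi⟩

/-! ## §2 The λ-grid step between consecutive combined files on the segment from `F_B` to `F_A` -/

/-- **Grid step, UPPER half.** On the segment `F(s) = Model.lincomb (1 − s) s F_B F_A`
(`Ĥ(F(s)) = Ĥ(F_B) + s·V`, `V = Ĥ(F_A) − Ĥ(F_B)`), for rationals `s ≤ t` and `hi` with `Re⟨ψ, Vψ⟩ ≤ hi`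
for every unit sector ground eigenvector `ψ` of `Ĥ(F(s))`:
`DiffUpperRow (F(t)) a b (F(s)) a b ((t − s)·hi)` — one Riemann panel
(`sectorGroundEnergy_pencil_sub_le_of_forall_eigen`); panels chain by `DiffUpperRow.trans`.
[cite: Thirring2002QMP, (4.3.20; 1)] -/
theorem diffUpperRow_segment_of_forall_ground {FA FB : Model k} (hA : FA.IsSymmetric)
    (hB : FB.IsSymmetric) {a b : ℕ} (ha : a ≤ k) (hb : b ≤ k) {s t : ℚ} (hst : s ≤ t) {hi : ℚ}
    (hslope : ∀ ψ : Fock (Orb (Fin k)), IsInSector a b ψ → star ψ ⬝ᵥ ψ = 1 →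
      (Model.lincomb (1 - s) s FB FA).hamiltonian *ᵥ ψ =
        (((Model.lincomb (1 - s) s FB FA).energy a b : ℝ) : ℂ) • ψ →
        (star ψ ⬝ᵥ (FA.hamiltonian - FB.hamiltonian) *ᵥ ψ).re ≤ ((hi : ℚ) : ℝ)) :
    DiffUpperRow (Model.lincomb (1 - t) t FB FA) a b (Model.lincomb (1 - s) s FB FA) a b
      ((t - s) * hi) := by
  refine ⟨⟨ha, hb⟩, ⟨ha, hb⟩, ?_⟩
  simp only [Model.energy] at hslope ⊢
  rw [Model.hamiltonian_segment] at hslope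
  rw [Model.hamiltonian_segment, Model.hamiltonian_segment]
  have h := sectorGroundEnergy_pencil_sub_le_of_forall_eigen (Model.hamiltonian_isHermitian hB)
    ((Model.hamiltonian_isHermitian hA).sub (Model.hamiltonian_isHermitian hB))
    (molecularHamiltonian_commute_totalNumber _ _ _) (molecularHamiltonian_commute_spinZ _ _ _)
    ((molecularHamiltonian_commute_totalNumber _ _ _).sub_left
      (molecularHamiltonian_commute_totalNumber _ _ _))
    ((molecularHamiltonian_commute_spinZ _ _ _).sub_left (molecularHamiltonian_commute_spinZ _ _ _))
    (by simpa using ha) (by simpa using hb) (show ((s : ℚ) : ℝ) ≤ t by exact_mod_cast hst) hslope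
  push_cast
  exact h

/-- **Grid step, LOWER half.** On the same segment, for rationals `s ≤ t` and `lo` with
`lo ≤ Re⟨φ, Vφ⟩` for every unit sector ground eigenvector `φ` of `Ĥ(F(t))`:
`DiffLowerRow (F(t)) a b (F(s)) a b ((t − s)·lo)` (`mul_le_sectorGroundEnergy_pencil_sub_of_forall_eigen`);
panels chain by `DiffLowerRow.trans`. [cite: Thirring2002QMP, (4.3.20; 1)] -/
theorem diffLowerRow_segment_of_forall_ground {FA FB : Model k} (hA : FA.IsSymmetric)
    (hB : FB.IsSymmetric) {a b : ℕ} (ha : a ≤ k) (hb : b ≤ k) {s t : ℚ} (hst : s ≤ t) {lo : ℚ}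
    (hslope : ∀ φ : Fock (Orb (Fin k)), IsInSector a b φ → star φ ⬝ᵥ φ = 1 →
      (Model.lincomb (1 - t) t FB FA).hamiltonian *ᵥ φ =
        (((Model.lincomb (1 - t) t FB FA).energy a b : ℝ) : ℂ) • φ →
        ((lo : ℚ) : ℝ) ≤ (star φ ⬝ᵥ (FA.hamiltonian - FB.hamiltonian) *ᵥ φ).re) :
    DiffLowerRow (Model.lincomb (1 - t) t FB FA) a b (Model.lincomb (1 - s) s FB FA) a b
      ((t - s) * lo) := by
  refine ⟨⟨ha, hb⟩, ⟨ha, hb⟩, ?_⟩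
  simp only [Model.energy] at hslope ⊢
  rw [Model.hamiltonian_segment] at hslope
  rw [Model.hamiltonian_segment, Model.hamiltonian_segment]
  have h := mul_le_sectorGroundEnergy_pencil_sub_of_forall_eigen (Model.hamiltonian_isHermitian hB)
    ((Model.hamiltonian_isHermitian hA).sub (Model.hamiltonian_isHermitian hB))
    (molecularHamiltonian_commute_totalNumber _ _ _) (molecularHamiltonian_commute_spinZ _ _ _)
    ((molecularHamiltonian_commute_totalNumber _ _ _).sub_left
      (molecularHamiltonian_commute_totalNumber _ _ _))
    ((molecularHamiltonian_commute_spinZ _ _ _).sub_left (molecularHamiltonian_commute_spinZ _ _ _))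
    (by simpa using ha) (by simpa using hb) (show ((s : ℚ) : ℝ) ≤ t by exact_mod_cast hst) hslope
  push_cast
  exact h

/-! ## §3 Certifying the enclosure: codimension-one gap certificate + one explicit state -/

/-- **Every ground eigenvector's expectation is enclosed** (generic, on a subspace `K`): under the
hypotheses of the tree's `TempleKato.sector_enclosure` (Hermitian `A`, `A`-invariant `K`, the `(W, u)`
gap data at level `σ`, a UNIT trial vector `w ∈ K` with `Re⟨w, Aw⟩ = ρ < σ`, `‖Aw‖² ≤ r2 + ρ²`), a
Hermitian `O` with form bound `|⟨x, (O − m)x⟩| ≤ h‖x‖²`, observable residual `‖(O − ⟨O⟩_w)w‖² ≤ sO²`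
and any `β ≥ 0` with `r2 ≤ β²(σ − ρ)²`: EVERY unit `ψ ∈ K` with `Aψ = (minEnergyOn A K)ψ` satisfies
`|Re⟨ψ, Oψ⟩ − Re⟨w, Ow⟩| ≤ 2βsO + β²(h + |Re⟨w, Ow⟩ − m|)` (the certificate makes the sector ground state
simple, so `ψ` is a phase multiple of the enclosed one; `TempleKato.abs_expect_sub_expect_le_of_residual`).
Saad (1992) Ch. III §3.2 Thms 3.8–3.9 via the tree. [folklore] -/
theorem forall_eigen_abs_re_rayleigh_sub_le {ι : Type*} [Fintype ι] [DecidableEq ι]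
    {A : Matrix ι ι ℂ} (hA : A.IsHermitian) (K : Submodule ℂ (ι → ℂ)) (hKA : ∀ v ∈ K, A *ᵥ v ∈ K)
    {W : Submodule ℂ (ι → ℂ)} {u : ι → ℂ} {σ : ℝ}
    (hW : ∀ z ∈ W, σ * (star z ⬝ᵥ z).re ≤ (star z ⬝ᵥ A *ᵥ z).re)
    (hWK : ∀ x ∈ K, ∃ z ∈ W, ∃ c : ℂ, x = z + c • u)
    {w : ι → ℂ} (hwK : w ∈ K) (hw1 : star w ⬝ᵥ w = 1) {ρ r2 : ℝ}
    (hρ : (star w ⬝ᵥ A *ᵥ w).re = ρ) (hr2 : (star (A *ᵥ w) ⬝ᵥ A *ᵥ w).re ≤ r2 + ρ ^ 2)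
    (hρσ : ρ < σ) {O : Matrix ι ι ℂ} (hO : Oᴴ = O) {m h β sO : ℝ}
    (hOform : ∀ x : ι → ℂ, ‖star x ⬝ᵥ O *ᵥ x - (m : ℂ) * (star x ⬝ᵥ x)‖ ≤ h * (star x ⬝ᵥ x).re)
    (hβ : 0 ≤ β) (hβr : r2 ≤ β ^ 2 * (σ - ρ) ^ 2) (hsO : 0 ≤ sO)
    (hres : (star (O *ᵥ w - ((star w ⬝ᵥ O *ᵥ w).re : ℂ) • w) ⬝ᵥ
      (O *ᵥ w - ((star w ⬝ᵥ O *ᵥ w).re : ℂ) • w)).re ≤ sO ^ 2)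
    {ψ : ι → ℂ} (hψK : ψ ∈ K) (hψ1 : star ψ ⬝ᵥ ψ = 1)
    (hAψ : A *ᵥ ψ = ((A.minEnergyOn K : ℝ) : ℂ) • ψ) :
    |(star ψ ⬝ᵥ O *ᵥ ψ).re - (star w ⬝ᵥ O *ᵥ w).re| ≤
      2 * β * sO + β ^ 2 * (h + |(star w ⬝ᵥ O *ᵥ w).re - m|) := by
  obtain ⟨-, -, ψ₀, hψ₀K, hψ₀1, hAψ₀, huniq, -, hsin⟩ :=
    TempleKato.sector_enclosure hA K hKA hW hWK hwK hw1 hρ hr2 hρσ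
  have hψeq := huniq ψ hψK hAψ
  set c : ℂ := star ψ₀ ⬝ᵥ ψ with hc
  have hcc : star c * c = 1 := by
    have h1 := hψ1
    rw [hψeq, star_smul, smul_dotProduct, dotProduct_smul, hψ₀1, smul_eq_mul, smul_eq_mul,
      mul_one] at h1
    exact h1
  have hOψ : (star ψ ⬝ᵥ O *ᵥ ψ).re = (star ψ₀ ⬝ᵥ O *ᵥ ψ₀).re := by
    rw [hψeq, RayleighBottom.star_smul_dotProduct_mulVec_smul, hcc, one_mul]
  rw [hOψ]
  have hσρ : 0 < (σ - ρ) ^ 2 := by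
    have := sub_pos.2 hρσ
    positivity
  have hover : 1 - ‖star w ⬝ᵥ ψ₀‖ ^ 2 ≤ β ^ 2 := by
    have hsym : ‖star w ⬝ᵥ ψ₀‖ = ‖star ψ₀ ⬝ᵥ w‖ := by rw [star_dotProduct, norm_star]
    rw [hsym]
    exact le_of_mul_le_mul_right (hsin.trans hβr) hσρ
  exact TempleKato.abs_expect_sub_expect_le_of_residual hO hOform hψ₀1 hw1 hβ hover hsO hres

/-- **THE SLOPE/EXPECTATION ENCLOSURE FROM A CERTIFICATE** (row-level inputs, unnormalised exact sums).
For a symmetric model `F`, a codimension-one gap certificate `GapCertificateCodimOne F a b σ`, one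
explicit sector vector `w` with `N = ⟨w, w⟩ > 0`, `⟨w, H_F w⟩ = ρN`, `⟨H_F w, H_F w⟩ ≤ (r2 + ρ²)N`,
`ρ < σ`; a Hermitian observable `O` with a form bound `|⟨x, (O − m)x⟩| ≤ h‖x‖²` (all `x`), exact data
`⟨w, Ow⟩ = oN`, `‖Ow − o·w‖² ≤ sO²·N` (`sO ≥ 0`); and `β ≥ 0` with `r2 ≤ β²(σ − ρ)²`: every unit
`(a, b)`-sector ground eigenvector `ψ` of `H_F` has `|Re⟨ψ, Oψ⟩ − o| ≤ 2βsO + β²(h + |o − m|)`.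
(Normalise `w` and apply `forall_eigen_abs_re_rayleigh_sub_le`.) With `O = Ĥ(F_A) − Ĥ(F_B)` and
`F = F_B` (resp. `F_A`) this is the hypothesis of `diffUpperRow_of_forall_ground` (resp. `diffLowerRow_…`).
[folklore] -/
theorem forall_ground_abs_re_rayleigh_sub_le {F : Model k} (hF : F.IsSymmetric) {a b : ℕ} {σ : ℚ}
    (hG : GapCertificateCodimOne F a b σ) {w : Fock (Orb (Fin k))} (hw : IsInSector a b w)
    {N ρ r2 : ℝ} (hN : 0 < N) (hwN : (star w ⬝ᵥ w).re = N)
    (hρ : (star w ⬝ᵥ F.hamiltonian *ᵥ w).re = ρ * N)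
    (hr2 : (star (F.hamiltonian *ᵥ w) ⬝ᵥ F.hamiltonian *ᵥ w).re ≤ (r2 + ρ ^ 2) * N)
    (hρσ : ρ < ((σ : ℚ) : ℝ))
    {O : Matrix (Finset (Orb (Fin k))) (Finset (Orb (Fin k))) ℂ} (hO : O.IsHermitian)
    {o m h β sO : ℝ}
    (hOform : ∀ x : Fock (Orb (Fin k)),
      ‖star x ⬝ᵥ O *ᵥ x - (m : ℂ) * (star x ⬝ᵥ x)‖ ≤ h * (star x ⬝ᵥ x).re)
    (ho : (star w ⬝ᵥ O *ᵥ w).re = o * N) (hsO : 0 ≤ sO)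
    (hres : (star (O *ᵥ w - (o : ℂ) • w) ⬝ᵥ (O *ᵥ w - (o : ℂ) • w)).re ≤ sO ^ 2 * N)
    (hβ : 0 ≤ β) (hβr : r2 ≤ β ^ 2 * (((σ : ℚ) : ℝ) - ρ) ^ 2)
    {ψ : Fock (Orb (Fin k))} (hψ : IsInSector a b ψ) (hψ1 : star ψ ⬝ᵥ ψ = 1)
    (hHψ : F.hamiltonian *ᵥ ψ = ((F.energy a b : ℝ) : ℂ) • ψ) :
    |(star ψ ⬝ᵥ O *ᵥ ψ).re - o| ≤ 2 * β * sO + β ^ 2 * (h + |o - m|) := by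
  obtain ⟨W, u, hW, hWK⟩ := hG.exists_codimOne
  have hH : F.hamiltonian.IsHermitian := Model.hamiltonian_isHermitian hF
  set K : Submodule ℂ (Fock (Orb (Fin k))) := szSector (a + b) (((a : ℝ) - b) / 2) with hKdef
  have hKH : ∀ x ∈ K, F.hamiltonian *ᵥ x ∈ K := fun x hx =>
    molecularHamiltonian_mulVec_mem_szSector _ _ _ hx
  -- normalise the trial vector
  have hw0 : w ≠ 0 := by
    rintro rfl
    rw [dotProduct_zero, Complex.zero_re] at hwN
    exact hN.ne' hwN.symm
  obtain ⟨c, hc, hcc, hc1⟩ := exists_normalize hw0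
  rw [hwN] at hcc
  set w' : Fock (Orb (Fin k)) := (c : ℂ) • w with hw'
  have hw'K : w' ∈ K := K.smul_mem _ ((mem_szSector_iff_isInSector a b w).2 hw)
  have hρ' : (star w' ⬝ᵥ F.hamiltonian *ᵥ w').re = ρ := by
    rw [hw', re_star_smul_dotProduct_mulVec_smul, hρ, ← mul_assoc, mul_comm (c * c), mul_assoc, hcc,
      mul_one]
  have hr2' : (star (F.hamiltonian *ᵥ w') ⬝ᵥ F.hamiltonian *ᵥ w').re ≤ r2 + ρ ^ 2 := by
    rw [hw', mulVec_smul, star_real_smul_dotProduct_real_smul, Complex.re_ofReal_mul]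
    calc c * c * (star (F.hamiltonian *ᵥ w) ⬝ᵥ F.hamiltonian *ᵥ w).re
        ≤ c * c * ((r2 + ρ ^ 2) * N) := mul_le_mul_of_nonneg_left hr2 (mul_self_nonneg c)
      _ = r2 + ρ ^ 2 := by rw [← mul_assoc, mul_comm (c * c), mul_assoc, hcc, mul_one]
  have ho' : (star w' ⬝ᵥ O *ᵥ w').re = o := by
    rw [hw', re_star_smul_dotProduct_mulVec_smul, ho, ← mul_assoc, mul_comm (c * c), mul_assoc, hcc,
      mul_one]
  have hres' : (star (O *ᵥ w' - ((star w' ⬝ᵥ O *ᵥ w').re : ℂ) • w') ⬝ᵥ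
      (O *ᵥ w' - ((star w' ⬝ᵥ O *ᵥ w').re : ℂ) • w')).re ≤ sO ^ 2 := by
    rw [ho']
    have e1 : O *ᵥ w' - (o : ℂ) • w' = (c : ℂ) • (O *ᵥ w - (o : ℂ) • w) := by
      rw [hw', mulVec_smul, smul_sub, smul_comm]
    rw [e1, star_real_smul_dotProduct_real_smul, Complex.re_ofReal_mul]
    calc c * c * (star (O *ᵥ w - (o : ℂ) • w) ⬝ᵥ (O *ᵥ w - (o : ℂ) • w)).re
        ≤ c * c * (sO ^ 2 * N) := mul_le_mul_of_nonneg_left hres (mul_self_nonneg c)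
      _ = sO ^ 2 := by rw [← mul_assoc, mul_comm (c * c), mul_assoc, hcc, mul_one]
  have hE : F.energy a b = F.hamiltonian.minEnergyOn K := rfl
  rw [hE] at hHψ
  have key := forall_eigen_abs_re_rayleigh_sub_le hH K hKH hW hWK hw'K hc1 hρ' hr2' hρσ hO.eq hOform
    hβ hβr hsO hres' ((mem_szSector_iff_isInSector a b ψ).2 hψ) hψ1 hHψ
  rw [ho'] at key
  exact key

/-! ## §4 End to end: slope certificate ⇒ first-order difference row -/

/-- **UPPER difference row from a slope certificate at `B`.** With the data of
`forall_ground_abs_re_rayleigh_sub_le` for `F = F_B` and the observable `O = Ĥ(F_A) − Ĥ(F_B)`, every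
rational `hi ≥ o + 2βsO + β²(h + |o − m|)` is a certified `DiffUpperRow F_A a b F_B a b hi`
(`E₀(A) − E₀(B) ≤ ⟨V⟩_{ψ_B} ≤ o + slack`). [cite: Thirring2002QMP, (4.3.20; 1)] -/
theorem diffUpperRow_of_slope_certificate {FA FB : Model k} (hA : FA.IsSymmetric)
    (hB : FB.IsSymmetric) {a b : ℕ} {σ : ℚ} (hG : GapCertificateCodimOne FB a b σ)
    {w : Fock (Orb (Fin k))} (hw : IsInSector a b w) {N ρ r2 : ℝ} (hN : 0 < N)
    (hwN : (star w ⬝ᵥ w).re = N) (hρ : (star w ⬝ᵥ FB.hamiltonian *ᵥ w).re = ρ * N)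
    (hr2 : (star (FB.hamiltonian *ᵥ w) ⬝ᵥ FB.hamiltonian *ᵥ w).re ≤ (r2 + ρ ^ 2) * N)
    (hρσ : ρ < ((σ : ℚ) : ℝ)) {o m h β sO : ℝ}
    (hOform : ∀ x : Fock (Orb (Fin k)),
      ‖star x ⬝ᵥ (FA.hamiltonian - FB.hamiltonian) *ᵥ x - (m : ℂ) * (star x ⬝ᵥ x)‖ ≤
        h * (star x ⬝ᵥ x).re)
    (ho : (star w ⬝ᵥ (FA.hamiltonian - FB.hamiltonian) *ᵥ w).re = o * N) (hsO : 0 ≤ sO)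
    (hres : (star ((FA.hamiltonian - FB.hamiltonian) *ᵥ w - (o : ℂ) • w) ⬝ᵥ
      ((FA.hamiltonian - FB.hamiltonian) *ᵥ w - (o : ℂ) • w)).re ≤ sO ^ 2 * N)
    (hβ : 0 ≤ β) (hβr : r2 ≤ β ^ 2 * (((σ : ℚ) : ℝ) - ρ) ^ 2) {hi : ℚ}
    (hhi : o + (2 * β * sO + β ^ 2 * (h + |o - m|)) ≤ ((hi : ℚ) : ℝ)) :
    DiffUpperRow FA a b FB a b hi := by
  have hw0 : w ≠ 0 := by
    rintro rfl
    rw [dotProduct_zero, Complex.zero_re] at hwN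
    exact hN.ne' hwN.symm
  obtain ⟨ha, hb⟩ := range_of_isInSector_ne_zero hw hw0
  have hO : (FA.hamiltonian - FB.hamiltonian).IsHermitian :=
    (Model.hamiltonian_isHermitian hA).sub (Model.hamiltonian_isHermitian hB)
  refine diffUpperRow_of_forall_ground hA hB ha hb fun ψ hψ hψ1 hHψ => ?_
  have henc := forall_ground_abs_re_rayleigh_sub_le hB hG hw hN hwN hρ hr2 hρσ hO hOform ho hsO
    hres hβ hβr hψ hψ1 hHψ
  linarith [(abs_le.1 henc).2]

/-- **LOWER difference row from a slope certificate at `A`.** With the data of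
`forall_ground_abs_re_rayleigh_sub_le` for `F = F_A` and `O = Ĥ(F_A) − Ĥ(F_B)`, every rational
`lo ≤ o − 2βsO − β²(h + |o − m|)` is a certified `DiffLowerRow F_A a b F_B a b lo`
(`lo ≤ o − slack ≤ ⟨V⟩_{ψ_A} ≤ E₀(A) − E₀(B)`). [cite: Thirring2002QMP, (4.3.20; 1)] -/
theorem diffLowerRow_of_slope_certificate {FA FB : Model k} (hA : FA.IsSymmetric)
    (hB : FB.IsSymmetric) {a b : ℕ} {σ : ℚ} (hG : GapCertificateCodimOne FA a b σ)
    {w : Fock (Orb (Fin k))} (hw : IsInSector a b w) {N ρ r2 : ℝ} (hN : 0 < N)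
    (hwN : (star w ⬝ᵥ w).re = N) (hρ : (star w ⬝ᵥ FA.hamiltonian *ᵥ w).re = ρ * N)
    (hr2 : (star (FA.hamiltonian *ᵥ w) ⬝ᵥ FA.hamiltonian *ᵥ w).re ≤ (r2 + ρ ^ 2) * N)
    (hρσ : ρ < ((σ : ℚ) : ℝ)) {o m h β sO : ℝ}
    (hOform : ∀ x : Fock (Orb (Fin k)),
      ‖star x ⬝ᵥ (FA.hamiltonian - FB.hamiltonian) *ᵥ x - (m : ℂ) * (star x ⬝ᵥ x)‖ ≤
        h * (star x ⬝ᵥ x).re)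
    (ho : (star w ⬝ᵥ (FA.hamiltonian - FB.hamiltonian) *ᵥ w).re = o * N) (hsO : 0 ≤ sO)
    (hres : (star ((FA.hamiltonian - FB.hamiltonian) *ᵥ w - (o : ℂ) • w) ⬝ᵥ
      ((FA.hamiltonian - FB.hamiltonian) *ᵥ w - (o : ℂ) • w)).re ≤ sO ^ 2 * N)
    (hβ : 0 ≤ β) (hβr : r2 ≤ β ^ 2 * (((σ : ℚ) : ℝ) - ρ) ^ 2) {lo : ℚ}
    (hlo : ((lo : ℚ) : ℝ) ≤ o - (2 * β * sO + β ^ 2 * (h + |o - m|))) :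
    DiffLowerRow FA a b FB a b lo := by
  have hw0 : w ≠ 0 := by
    rintro rfl
    rw [dotProduct_zero, Complex.zero_re] at hwN
    exact hN.ne' hwN.symm
  obtain ⟨ha, hb⟩ := range_of_isInSector_ne_zero hw hw0
  have hO : (FA.hamiltonian - FB.hamiltonian).IsHermitian :=
    (Model.hamiltonian_isHermitian hA).sub (Model.hamiltonian_isHermitian hB)
  refine diffLowerRow_of_forall_ground hA hB ha hb fun φ hφ hφ1 hHφ => ?_
  have henc := forall_ground_abs_re_rayleigh_sub_le hA hG hw hN hwN hρ hr2 hρσ hO hOform ho hsO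
    hres hβ hβr hφ hφ1 hHφ
  linarith [(abs_le.1 henc).1]

end Summit.Ventures.CertifiedQuantumChemistry

end
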